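import Summits.BirchSwinnertonDyer.BirchSwinnertonDyer.Theorems.GenusKolyvaginAtTwoFullVertexDefs
import Mathlib.Data.Matrix.Mul
import Mathlib.Tactic.LinearCombination
import Mathlib.Tactic.ReduceModChar
import HarnessLib

/-!
# SEL (iso-class Selmer pair law), V-a: linear algebra of the Rédei–Laplacian over `𝔽₂`

Crux R″ `RankOneTwoTorsionResidualAtTwo` (stmt-27478), LINE 49 «full_vertex», SUPPORT stub SEL
`IsoClassSelmerPairLawAtTwo`.  Pure `𝔽₂`-linear algebra of the line's `redeiLaplacian Q` (`Ĝ`) and `phi3` (`Φ₃`), the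
objects of `…FullVertexDefs`, as needed to COUNT the solutions of the row system of parts II–IV:

* `mulVec_redeiLaplacian_apply` — the bridge to the inline symbols of parts I–IV: `(Ĝ χ) j = Σ_{i≠j} [−i/j] χ i + g_j χ j`.
* `redeiLaplacian_mulVec_one` (`Ĝ𝟙 = 0`), `phi3_mulVec_const` (`Φ₃(Ĝ)(c𝟙) = c𝟙`).
* `rows_iff_phi3` — the row system `(Ĝ + εI)χ_a + χ_b = τ₁𝟙`, `χ_a + (Ĝ + (ε+1)I)χ_b = τ₂𝟙` is equivalent to
  `χ_b = τ₁𝟙 + (Ĝ + εI)χ_a` together with `Φ₃(Ĝ)χ_a = (τ₂ + (ε+1)τ₁)𝟙` (memo #3 §4: «`ε` cancels»).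
* `natCard_phi3_fiber_eq` — each fibre `{χ : Φ₃(Ĝ)χ = c𝟙}` has `#ker Φ₃(Ĝ)` elements (it contains `c𝟙`).

Everything is proved; no LINE 49 statement is restated; BSD is not advanced by this file alone.

## References

* [HeathBrown1994SelmerCongruentII] D. R. Heath-Brown, Invent. Math. 118 (1994), §2.
* [Kane2013SelmerTwists] D. M. Kane, Algebra Number Theory 7 (2013), §2.
-/

namespace Summit.BirchSwinnertonDyer.BirchSwinnertonDyer.Theorems.GenusKolyvaginAtTwo.FullVertex

open Matrix

variable (Q : Finset ℕ)

/-! ## The Laplacian applied to a vector -/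

/-- **Bridge to the inline symbols**: for `χ : Q → 𝔽₂` and `j ∈ Q`,
`(Ĝ χ) j = Σ_{i ∈ Q, i ≠ j} [−i/j]·χ i + (Σ_{i ∈ Q, i ≠ j} [−i/j])·χ j`. [cite: HeathBrown1994SelmerCongruentII, §2] -/
theorem mulVec_redeiLaplacian_apply (χ : Q → ZMod 2) (j : Q) :
    (redeiLaplacian Q *ᵥ χ) j =
      (∑ i : Q, (if i = j then 0 else legendreBit (-((i : ℕ) : ℤ)) j) * χ i) +
        (∑ i : Q, if i = j then 0 else legendreBit (-((i : ℕ) : ℤ)) j) * χ j := by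
  rw [Matrix.mulVec, dotProduct]
  have : ∀ i : Q, redeiLaplacian Q j i * χ i =
      (if i = j then 0 else legendreBit (-((i : ℕ) : ℤ)) j) * χ i +
        (if i = j then (∑ i' : Q, if i' = j then 0 else legendreBit (-((i' : ℕ) : ℤ)) j) * χ j else 0) := by
    intro i
    unfold redeiLaplacian
    by_cases hij : i = j
    · subst hij; simp
    · simp [hij]
  rw [Finset.sum_congr rfl fun i _ => this i, Finset.sum_add_distrib, Finset.sum_ite_eq' Finset.univ j,
    if_pos (Finset.mem_univ j)]

/-- **`Ĝ𝟙 = 0`**: the rows of the Laplacian sum to zero. [cite: HeathBrown1994SelmerCongruentII, §2] -/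
theorem redeiLaplacian_mulVec_const (c : ZMod 2) : redeiLaplacian Q *ᵥ (fun _ => c) = 0 := by
  ext j
  rw [mulVec_redeiLaplacian_apply, Pi.zero_apply, ← Finset.sum_mul, CharTwo.add_self_eq_zero]

/-- `𝔽₂` arithmetic: `ε² + ε = 0`. [folklore] -/
private theorem mul_self_add_self_eq_zero (ε : ZMod 2) : ε * ε + ε = 0 := by revert ε; decide

/-- **`Φ₃(Ĝ)(c𝟙) = c𝟙`** (`Ĝ𝟙 = 0`). [cite: HeathBrown1994SelmerCongruentII, §2] -/
theorem phi3_mulVec_const (c : ZMod 2) : phi3 (redeiLaplacian Q) *ᵥ (fun _ => c) = fun _ => c := by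
  unfold phi3
  rw [add_mulVec, add_mulVec, ← mulVec_mulVec, redeiLaplacian_mulVec_const, mulVec_zero, zero_add, zero_add, one_mulVec]

/-! ## The row system and `Φ₃` -/

/-- **The row system ⟺ `Φ₃(Ĝ)χ_a = (τ₂ + (ε+1)τ₁)𝟙` with `χ_b` determined** («`ε` cancels», memo #3 §4): for
`χ_a, χ_b : Q → 𝔽₂` and bits `ε, τ₁, τ₂`, the system `(Ĝχ_a) + εχ_a + χ_b = τ₁𝟙 ∧ (Ĝχ_b) + (ε+1)χ_b + χ_a = τ₂𝟙` holds iff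
`χ_b = τ₁𝟙 + Ĝχ_a + εχ_a` and `Φ₃(Ĝ)χ_a = (τ₂ + (ε+1)τ₁)𝟙`. [cite: HeathBrown1994SelmerCongruentII, §2]
[cite: Kane2013SelmerTwists, §2] -/
theorem rows_iff_phi3 (ε τ₁ τ₂ : ZMod 2) (χa χb : Q → ZMod 2) :
    ((∀ j : Q, (redeiLaplacian Q *ᵥ χa) j + ε * χa j + χb j = τ₁) ∧
      (∀ j : Q, (redeiLaplacian Q *ᵥ χb) j + (ε + 1) * χb j + χa j = τ₂)) ↔
    ((χb = fun j => τ₁ + (redeiLaplacian Q *ᵥ χa) j + ε * χa j) ∧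
      phi3 (redeiLaplacian Q) *ᵥ χa = fun _ => τ₂ + (ε + 1) * τ₁) := by
  -- `χ_b` as a vector expression
  have hvec : ∀ χa : Q → ZMod 2, (fun j => τ₁ + (redeiLaplacian Q *ᵥ χa) j + ε * χa j) =
      (fun _ => τ₁) + redeiLaplacian Q *ᵥ χa + ε • χa := by
    intro χa; ext j; simp [Pi.add_apply, Pi.smul_apply]
  -- `Ĝ` applied to that vector
  have hG : ∀ χa : Q → ZMod 2, redeiLaplacian Q *ᵥ (fun j => τ₁ + (redeiLaplacian Q *ᵥ χa) j + ε * χa j) =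
      (redeiLaplacian Q * redeiLaplacian Q) *ᵥ χa + ε • (redeiLaplacian Q *ᵥ χa) := by
    intro χa
    rw [hvec, mulVec_add, mulVec_add, redeiLaplacian_mulVec_const, zero_add, mulVec_mulVec, mulVec_smul]
  have hphi : ∀ (χa : Q → ZMod 2) (j : Q), (phi3 (redeiLaplacian Q) *ᵥ χa) j =
      ((redeiLaplacian Q * redeiLaplacian Q) *ᵥ χa) j + (redeiLaplacian Q *ᵥ χa) j + χa j := by
    intro χa j
    unfold phi3
    rw [add_mulVec, add_mulVec, one_mulVec, Pi.add_apply, Pi.add_apply]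
  have hεε : ε * ε + ε = 0 := mul_self_add_self_eq_zero ε
  constructor
  · rintro ⟨h1, h2⟩
    have hb : χb = fun j => τ₁ + (redeiLaplacian Q *ᵥ χa) j + ε * χa j := by
      ext j
      have := h1 j
      -- `x + y + χb j = τ₁ ⟹ χb j = τ₁ + x + y` in characteristic `2`
      linear_combination (norm := skip) this
      ring_nf
      try reduce_mod_char
      try simp
    refine ⟨hb, ?_⟩
    ext j
    have h2j := h2 j
    rw [hb, hG] at h2j
    simp only [Pi.add_apply, Pi.smul_apply, smul_eq_mul] at h2j
    rw [hphi]
    linear_combination (norm := skip) h2j + χa j * hεε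
    ring_nf
    try reduce_mod_char
    try simp
  · rintro ⟨hb, hphi3⟩
    constructor
    · intro j
      rw [hb]
      ring_nf
      try reduce_mod_char
      try simp
    · intro j
      have hj := congrFun hphi3 j
      rw [hphi] at hj
      rw [hb, hG]
      simp only [Pi.add_apply, Pi.smul_apply, smul_eq_mul]
      linear_combination (norm := skip) hj - χa j * hεε
      ring_nf
      try reduce_mod_char
      try simp

/-! ## Counting the fibres of `Φ₃(Ĝ)` -/

/-- **Each fibre `{χ : Φ₃(Ĝ)χ = c𝟙}` is a translate of the kernel**: it has `#ker Φ₃(Ĝ)` elements (it contains `c𝟙`).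
[cite: HeathBrown1994SelmerCongruentII, §2] -/
theorem natCard_phi3_fiber_eq (c : ZMod 2) :
    Nat.card {χ : Q → ZMod 2 // phi3 (redeiLaplacian Q) *ᵥ χ = fun _ => c} =
      Nat.card (LinearMap.ker (phi3 (redeiLaplacian Q)).mulVecLin) := by
  refine Nat.card_congr
    { toFun := fun χ => ⟨χ.1 - fun _ => c, by
        rw [LinearMap.mem_ker, Matrix.mulVecLin_apply, mulVec_sub, χ.2, phi3_mulVec_const, sub_self]⟩
      invFun := fun κ => ⟨κ.1 + fun _ => c, by
        have hκ := κ.2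
        rw [LinearMap.mem_ker, Matrix.mulVecLin_apply] at hκ
        rw [mulVec_add, hκ, phi3_mulVec_const, zero_add]⟩
      left_inv := fun χ => Subtype.ext (sub_add_cancel χ.1 _)
      right_inv := fun κ => Subtype.ext (add_sub_cancel_right κ.1 _) }

/-- **The solution count of the torsion-indexed row systems**: for the four right-hand sides `c ∈ {0, 0, 1, 1}` (two
torsion classes of each kind) the total number of solutions `χ_a` is `4·#ker Φ₃(Ĝ)`.
[cite: HeathBrown1994SelmerCongruentII, §2] [cite: Kane2013SelmerTwists, §2] -/
theorem natCard_sigma_phi3_fiber_eq (c : Fin 4 → ZMod 2) :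
    Nat.card (Σ k : Fin 4, {χ : Q → ZMod 2 // phi3 (redeiLaplacian Q) *ᵥ χ = fun _ => c k}) =
      4 * Nat.card (LinearMap.ker (phi3 (redeiLaplacian Q)).mulVecLin) := by
  classical
  rw [Nat.card_sigma, Finset.sum_congr rfl fun k _ => natCard_phi3_fiber_eq Q (c k), Finset.sum_const, Finset.card_univ,
    Fintype.card_fin, smul_eq_mul]

end Summit.BirchSwinnertonDyer.BirchSwinnertonDyer.Theorems.GenusKolyvaginAtTwo.FullVertex
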